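import Mathlib
import HarnessLib

/-!
# RiemannHypothesis / WeilGroundState — weak sequential compactness in `L²(ℝ)`

Route `RiemannHypothesis/WeilGroundState`, crux item stmt-RiemannHypothesis-1527
(`GroundStatesConvergeToXi`), line `Sketch`, registered stub (C1) `stub_weakL2_compact`
(helper file, `--supports`).

**Statement.** Every `L²`-bounded sequence `f_k : ℝ → ℂ` (`∫ ‖f_k‖² ≤ B`) has a subsequence
`f_{φ(k)}` and an `L²` function `v` with `∫ f_{φ(k)} g → ∫ v g` for every `g ∈ L²(ℝ)`
(test pairing without conjugation; `L²` is closed under `conj`, so this is ordinary weak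
convergence).

**Proof.** Pure functional analysis. `H = Lp ℂ 2 volume` is a separable Hilbert space
(`MeasureTheory.L2.innerProductSpace`, `MeasureTheory.Lp.SecondCountableTopology`); the classes
`F_k = toLp f_k` satisfy `‖F_k‖ = (∫ ‖f_k‖²)^{1/2} ≤ B^{1/2}`; the Riesz functionals
`toDual F_k` lie in a closed ball of `WeakDual ℂ H`, which is weak-* sequentially compact
(sequential Banach–Alaoglu, `WeakDual.isSeqCompact_closedBall`), giving `φ` and a weak limit
`a ∈ H` with `⟪F_{φ k}, G⟫ → ⟪a, G⟫` for all `G ∈ H`. Finally `∫ f g = ⟪toLp (conj ∘ g), toLp f⟫`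
(`MeasureTheory.L2.inner_def`), and `v` is a representative of `a`.

Mathlib only; no named fact is used; no definitions. The Hilbert-space lemma
`wL2c_exists_strictMono_tendsto_inner` is adapted from
`Literature/Analysis/FluidPDE/RusinSverakCompactnessProofs.lean`
(`Literature.Analysis.FluidPDE.exists_strictMono_tendsto_inner`).
-/

noncomputable section

set_option linter.dupNamespace false

open Filter Set MeasureTheory Complex
open scoped Topology Real ENNReal ComplexConjugate InnerProductSpace

namespace Summit.RiemannHypothesis.RiemannHypothesis.Theorems.GroundStatesConvergeToXi

-- adapted from Literature/Analysis/FluidPDE/RusinSverakCompactnessProofs.lean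
-- (`Literature.Analysis.FluidPDE.exists_strictMono_tendsto_inner`)
/-- **Weak sequential compactness of bounded sequences in a separable complex Hilbert space**:
if `‖x n‖ ≤ R` for all `n`, a subsequence converges weakly to some `a` with `‖a‖ ≤ R`, i.e.
`⟪x (φ n), w⟫ → ⟪a, w⟫` for every `w` (sequential Banach–Alaoglu in the weak-* dual,
`WeakDual.isSeqCompact_closedBall`, transported by the Riesz isometry
`InnerProductSpace.toDual`). [folklore] -/
theorem wL2c_exists_strictMono_tendsto_inner {H : Type*} [NormedAddCommGroup H]
    [InnerProductSpace ℂ H] [CompleteSpace H] [TopologicalSpace.SeparableSpace H] (x : ℕ → H)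
    {R : ℝ} (hx : ∀ n, ‖x n‖ ≤ R) :
    ∃ (a : H) (φ : ℕ → ℕ), StrictMono φ ∧ ‖a‖ ≤ R ∧
      ∀ w : H, Tendsto (fun n => ⟪x (φ n), w⟫_ℂ) atTop (𝓝 ⟪a, w⟫_ℂ) := by
  set ψ : ℕ → WeakDual ℂ H :=
    fun n => StrongDual.toWeakDual (InnerProductSpace.toDual ℂ H (x n)) with hψ
  have hmem : ∀ n, ψ n ∈ WeakDual.toStrongDual ⁻¹' Metric.closedBall (0 : StrongDual ℂ H) R := by
    intro n
    simp only [Set.mem_preimage, Metric.mem_closedBall, dist_zero_right, hψ,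
      StrongDual.toStrongDual_toWeakDual, LinearIsometryEquiv.norm_map]
    exact hx n
  obtain ⟨ℓ, hℓ, φ, hφ, hlim⟩ := (WeakDual.isSeqCompact_closedBall ℂ H 0 R) hmem
  refine ⟨(InnerProductSpace.toDual ℂ H).symm (WeakDual.toStrongDual ℓ), φ, hφ, ?_, ?_⟩
  · simp only [Set.mem_preimage, Metric.mem_closedBall, dist_zero_right] at hℓ
    simpa using hℓ
  · intro w
    rw [tendsto_iff_forall_eval_tendsto_topDualPairing] at hlim
    have h := hlim w
    simp only [topDualPairing_apply, Function.comp_apply, hψ, StrongDual.toWeakDual] at h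
    rw [InnerProductSpace.toDual_symm_apply]
    exact h

/-- The `L²` class of `f` has norm at most `B^{1/2}` when `∫ ‖f‖² ≤ B`
(`‖toLp f‖ = (∫ ‖f‖²)^{1/2}`, `MemLp.eLpNorm_eq_integral_rpow_norm`). [folklore] -/
theorem wL2c_norm_toLp_le {f : ℝ → ℂ} (hf : MemLp f 2 volume) {B : ℝ}
    (hB : ∫ t, ‖f t‖ ^ 2 ≤ B) : ‖hf.toLp f‖ ≤ B ^ (2 : ℝ)⁻¹ := by
  have h0 : 0 ≤ ∫ t, ‖f t‖ ^ (2 : ℝ) := integral_nonneg fun t => by positivity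
  have h2 : ∫ t, ‖f t‖ ^ (2 : ℝ) ≤ B := by simpa only [Real.rpow_two] using hB
  rw [Lp.norm_toLp, hf.eLpNorm_eq_integral_rpow_norm two_ne_zero ENNReal.ofNat_ne_top,
    ENNReal.toReal_ofNat, ENNReal.toReal_ofReal (Real.rpow_nonneg h0 _)]
  exact Real.rpow_le_rpow h0 h2 (by positivity)

/-- The `L²(ℝ)` inner product against the class `G` of `conj ∘ g` is the plain test pairing:
`⟪G, F⟫ = ∫ F g` (`MeasureTheory.L2.inner_def`, `⟪z, w⟫_ℂ = w · conj z`). [folklore] -/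
theorem wL2c_inner_eq_integral (F G : Lp ℂ 2 (volume : Measure ℝ)) {g : ℝ → ℂ}
    (hG : (G : ℝ → ℂ) =ᵐ[volume] fun t => conj (g t)) :
    ⟪G, F⟫_ℂ = ∫ t, F t * g t := by
  rw [MeasureTheory.L2.inner_def]
  refine integral_congr_ae ?_
  filter_upwards [hG] with t ht
  rw [ht]
  simp

/-- For `f ∈ L²(ℝ)` and the class `G` of `conj ∘ g`: `∫ f g = ⟪G, toLp f⟫`
(`wL2c_inner_eq_integral` and `MemLp.coeFn_toLp`). [folklore] -/
theorem wL2c_integral_mul_eq_inner {f g : ℝ → ℂ} (hf : MemLp f 2 volume)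
    (G : Lp ℂ 2 (volume : Measure ℝ)) (hG : (G : ℝ → ℂ) =ᵐ[volume] fun t => conj (g t)) :
    ∫ t, f t * g t = ⟪G, hf.toLp f⟫_ℂ := by
  rw [wL2c_inner_eq_integral (hf.toLp f) G hG]
  refine integral_congr_ae ?_
  filter_upwards [hf.coeFn_toLp] with t ht
  rw [ht]

/-- `L²(ℝ)` is closed under complex conjugation. [folklore] -/
theorem wL2c_memLp_conj {g : ℝ → ℂ} (hg : MemLp g 2 volume) :
    MemLp (fun t => conj (g t)) 2 volume :=
  hg.of_le (Complex.continuous_conj.comp_aestronglyMeasurable hg.aestronglyMeasurable)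
    (Eventually.of_forall fun _ => (Complex.norm_conj _).le)

/-- **Stub C1 — `weakL2_compact` (RH-free).**  Every `L²`-bounded sequence of functions on
`ℝ` has a subsequence converging weakly to an `L²` function: `∫ f_{φ(k)} g → ∫ v g` for every
`g ∈ L²` (Banach–Alaoglu in the separable Hilbert space `L²(ℝ)`: `WeakDual.isSeqCompact_closedBall`,
`Lp.SecondCountableTopology`, Riesz `InnerProductSpace.toDual`, `L2.inner_def`). [folklore] -/
theorem stub_weakL2_compact :
    ∀ (f : ℕ → ℝ → ℂ) (B : ℝ), (∀ k, MemLp (f k) 2 volume) → (∀ k, ∫ t, ‖f k t‖ ^ 2 ≤ B) →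
      ∃ φ : ℕ → ℕ, StrictMono φ ∧ ∃ v : ℝ → ℂ, MemLp v 2 volume ∧
        ∀ g : ℝ → ℂ, MemLp g 2 volume →
          Tendsto (fun k => ∫ t, f (φ k) t * g t) atTop (𝓝 (∫ t, v t * g t)) := by
  intro f B hf hB
  haveI : Fact ((2 : ℝ≥0∞) ≠ ∞) := ⟨ENNReal.ofNat_ne_top⟩
  obtain ⟨a, φ, hφ, -, hlim⟩ := wL2c_exists_strictMono_tendsto_inner
    (H := Lp ℂ 2 (volume : Measure ℝ)) (fun k => (hf k).toLp (f k))
    (fun k => wL2c_norm_toLp_le (hf k) (hB k))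
  refine ⟨φ, hφ, (a : ℝ → ℂ), Lp.memLp a, fun g hg => ?_⟩
  have hg' : MemLp (fun t => conj (g t)) 2 volume := wL2c_memLp_conj hg
  have hGae : (hg'.toLp _ : ℝ → ℂ) =ᵐ[volume] fun t => conj (g t) := hg'.coeFn_toLp
  have h1 : (fun k => ∫ t, f (φ k) t * g t) =
      fun k => ⟪hg'.toLp _, (hf (φ k)).toLp (f (φ k))⟫_ℂ :=
    funext fun k => wL2c_integral_mul_eq_inner (hf (φ k)) _ hGae
  rw [h1, ← wL2c_inner_eq_integral a _ hGae]
  have h4 := (Complex.continuous_conj.tendsto _).comp (hlim (hg'.toLp _))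
  simpa only [Function.comp_def, inner_conj_symm] using h4

/-- Curried form of `stub_weakL2_compact`: an `L²`-bounded sequence has a weakly convergent
subsequence (test pairing `∫ f g` against every `g ∈ L²(ℝ)`). [folklore] -/
theorem exists_subseq_weakL2_limit {f : ℕ → ℝ → ℂ} {B : ℝ} (hf : ∀ k, MemLp (f k) 2 volume)
    (hB : ∀ k, ∫ t, ‖f k t‖ ^ 2 ≤ B) :
    ∃ φ : ℕ → ℕ, StrictMono φ ∧ ∃ v : ℝ → ℂ, MemLp v 2 volume ∧
      ∀ g : ℝ → ℂ, MemLp g 2 volume →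
        Tendsto (fun k => ∫ t, f (φ k) t * g t) atTop (𝓝 (∫ t, v t * g t)) :=
  stub_weakL2_compact f B hf hB

end Summit.RiemannHypothesis.RiemannHypothesis.Theorems.GroundStatesConvergeToXi

end
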